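import Summits.Schanuel.Schanuel.Theorems.DiophantineDichotomyApproximationPropertyCycleAPIAt3Defs
import Summits.Schanuel.Schanuel.Theorems.DiophantineDichotomyApproximationPropertyCycleAPIAt3Trunk
import Summits.Schanuel.Schanuel.Theorems.DiophantineDichotomyApproximationPropertyCycleAPIAt3GlueLemmas
import Summits.Schanuel.Schanuel.Theorems.DiophantineDichotomyApproximationPropertyPointDatumOfClause
import Summits.Schanuel.Schanuel.Theorems.DiophantineDichotomyApproximationPropertyClauseFree
import Summits.Schanuel.Schanuel.Theorems.DiophantineDichotomyApproximationPropertySharpClosestPoint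
import Summits.Schanuel.Schanuel.Theorems.DiophantineDichotomyApproximationPropertyOrbitClusterBound
import Summits.Schanuel.Schanuel.Theorems.DiophantineDichotomyApproximationPropertyZeroDimDictionary
import HarnessLib

/-!
# Stub `pointDatum_of_lineSatellite3` of line `orbit-interpolation-determinant` (crux `ApproximationProperty`, stmt-Schanuel-6117)

Crux `stmt-Schanuel-6117` (`Summit.Schanuel.Schanuel.Theses.DiophantineDichotomy.ApproximationProperty`),
route `DiophantineDichotomy`, line `orbit-interpolation-determinant`, registered stub
`pointDatum_of_lineSatellite3` (the LINE-satellite branch of the bad cut of the `t = 3` transfer;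
vocabulary `…CycleAPIAt3Defs.lean`: `OrbitFloor`, `SatelliteHeightLine`, `ContainerRestart`).

The clause-free `t = 3` descent produced a long Galois orbit `V(𝔭)` (`D = deg 𝔭 > ⌊c₁Δ⌋ + 1`
points, AP1 bounds at constant `c₁` and boosted scale `(Δ, λY)`) lying on a rational LINE `V(𝔮')`
(`𝔮'` prime of rank `2`, `deg 𝔮' = 1`, a component of the cut-`2` complete intersection `(Q, P)`,
`a + b ≤ 3Δ`). From the three intermediate statements `OrbitFloor` (P2), `SatelliteHeightLine` (P3)
and `ContainerRestart` (P4), taken as HYPOTHESES, this file PROVES that `ω` is then approximated by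
ONE algebraic point with the `PointAPAbsAt 3` budgets at `(Δ, Y)`:

1. (floor, contrapositive) the smallness `|𝔭(ω̄)| ≤ exp(−(Δ h + λY D)/c₁)` forces a zero of `𝔭`
   within `e^{−L}` of `ω̄ = (1 : ω)`, `L = Δ(Δ h̄ + λY)/(32 C² c₁²)`, `h̄ = h/D` (`OrbitFloor` at
   `𝔮 := 𝔮'`, `SatelliteRestartGlue.sqrt_absorb`, `SatelliteRestartGlue.log_budget`, `floor_arith`);
2. hence `ρ(ω̄, V(𝔮')) < e^{−L}`, and `L` beats the restart threshold of the line
   (`SatelliteHeightLine`: `h(𝔮') ≤ C_H (h̄ + 1)`; `restart_threshold_arith`);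
3. the line is RESTARTED (`ContainerRestart`) into a short prime orbit `𝔯 ⊇ 𝔮'`, `deg 𝔯 ≤ 4Δ`,
   whose interpolation clause at level `⌊c₂Δ⌋` is automatic (`rankOne_interpolation_of_ideg_le`);
4. the landed per-scale transfer `pointDatum_of_clause` (with `stub_zeroDimDictionary`,
   `stub_sharpClosestPoint`, `stub_orbitClusterBound`) turns `𝔯` into the point datum.

The real bookkeeping is isolated in `PointDatumOfLineSatellite.{one_le_L, floor_contra,
height_budget}`. Proofs only (no definitions, no named facts).

Sources: NesterenkoPhilippon2001 (LNM 1752) Ch. 3 §4 (Prop. 4.11, Cor. 4.10), Ch. 4 §4 p. 61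
(AP1/AP2 for `n = 3`); Philippon2000 (doi:10.1006/jnth.1999.2461); folklore real analysis.
-/

noncomputable section

-- `Summit.Schanuel.Schanuel.…` is the mandated summit/sub-problem namespace (single-conjunct summit), hence:
set_option linter.dupNamespace false

attribute [local instance] MvPolynomial.gradedAlgebra

namespace Summit.Schanuel.Schanuel.Cruxes.ApproximationProperty.OrbitInterpolationDeterminant

open Literature.NumberTheory.Transcendental.Nesterenko MvPolynomial
open scoped BigOperators

namespace PointDatumOfLineSatellite

/-! ## Real arithmetic of the line-satellite branch -/

/-- The floor scale is at least `1`: `1 ≤ Δ(Δh̄ + Y)/(32 C² c²)` once `Δ ≥ 8 C c`, `Y ≥ Δ`,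
`h̄ ≥ 0`. [folklore] -/
theorem one_le_L {C c Δ Y hbar : ℝ} (hC : 1 ≤ C) (hc : 1 ≤ c) (hΔ : 8 * C * c ≤ Δ) (hY : Δ ≤ Y)
    (hh : 0 ≤ hbar) : 1 ≤ Δ * (Δ * hbar + Y) / (32 * C ^ 2 * c ^ 2) := by
  have hC0 : 0 < C := by linarith
  have hc0 : 0 < c := by linarith
  have hCc : 1 ≤ C * c := one_le_mul_of_one_le_of_one_le hC hc
  have hΔ0 : 0 ≤ Δ := by nlinarith
  rw [le_div_iff₀ (by positivity), one_mul]
  have h1 : (8 * C * c) ^ 2 ≤ Δ ^ 2 := pow_le_pow_left₀ (by positivity) hΔ 2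
  have h2 : Δ ^ 2 ≤ Δ * (Δ * hbar + Y) := by nlinarith [mul_nonneg hΔ0 (mul_nonneg hΔ0 hh)]
  have h3 : (8 * C * c) ^ 2 = 64 * (C ^ 2 * c ^ 2) := by ring
  have h4 : 0 ≤ C ^ 2 * c ^ 2 := by positivity
  nlinarith [h1, h2, h3, h4]

/-- **The floor contradiction** (Step 1 of the stub): if every zero of the long orbit `𝔭`
(`D ≥ Δ`, `D ≤ (cΔ)³`) stayed at projective distance `≥ e^{−L}` from `ω̄`,
`L = Δ(Δh̄ + Y)/(32 C² c²)`, then the orbit floor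
`log(1/|𝔭(ω̄)|) ≤ C_F (L + h + D log(D+2) + √(D (h + D + log(D+2)) L))` (`OrbitFloor` on a line,
`deg 𝔮' = 1`) and the smallness `(Δ h + Y D)/c ≤ log(1/|𝔭(ω̄)|)` are incompatible: after
`sqrt_absorb` and `log_budget`, `floor_arith` gives `2L ≤ L` with `L > 0`.
[cite: NesterenkoPhilippon2001, Ch. 3 Prop. 4.11 (pp. 40–41); Ch. 4 §4 p. 61] -/
theorem floor_contra {CF C c Δ Y D h S L : ℝ} (hCF : 0 < CF) (hC2 : 2 * CF ≤ C) (hC : 1 ≤ C)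
    (hc : 1 ≤ c) (hΔ8 : 8 * C * c ≤ Δ) (hΔbig : 3136 * C ^ 2 * c ^ 3 ≤ Δ) (hY : Δ ≤ Y)
    (hDΔ : Δ ≤ D) (hD9 : 9 ≤ D) (hDle : D ≤ (c * Δ) ^ 3) (hh : 0 ≤ h)
    (hL : L = Δ * (Δ * (h / D) + Y) / (32 * C ^ 2 * c ^ 2))
    (hlow : (Δ * h + Y * D) / c ≤ S)
    (hup : S ≤ CF * (1 * L + h + D * Real.log (D + 2) +
      Real.sqrt (D * (h + D + 1 * Real.log (D + 2)) * L))) : False := by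
  have hC0 : 0 < C := by linarith
  have hc0 : 0 < c := by linarith
  have hCc : 1 ≤ C * c := one_le_mul_of_one_le_of_one_le hC hc
  have hΔ0 : 0 < Δ := by nlinarith
  have hY0 : 0 < Y := by linarith
  have hD1 : 1 ≤ D := by linarith
  have hD0 : 0 < D := by linarith
  have hDne : D ≠ 0 := hD0.ne'
  set hbar : ℝ := h / D with hhbar
  have hhbar0 : 0 ≤ hbar := div_nonneg hh hD0.le
  have hhD : h = D * hbar := by rw [hhbar, mul_div_cancel₀ _ hDne]
  have hL1 : 1 ≤ L := by rw [hL]; exact one_le_L hC hc hΔ8 hY hhbar0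
  have hL0 : 0 ≤ L := by linarith
  have hsqrt := SatelliteRestartGlue.sqrt_absorb (δ := 1) hD1 hh hL0 zero_le_one
    (by rw [one_pow, mul_one]; exact hD9)
  have hlog0 : 0 ≤ Real.log (D + 2) := Real.log_nonneg (by linarith)
  have hstuff : 0 ≤ 1 * L + h + D * Real.log (D + 2) := by positivity
  have hT0 : 0 ≤ 1 * L + h + D * Real.log (D + 2) + Real.sqrt (D * (h + D) * L) := by positivity
  -- the floor inequality in the shape of `floor_arith` (`δ = 1`, constant `C ≥ 2 C_F`)
  have hfloor : D * (Δ * hbar + Y) / c ≤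
      C * (1 * L + D * hbar + D * Real.log (D + 2) + Real.sqrt (D * (D * hbar + D) * L)) := by
    have e1 : D * (Δ * hbar + Y) = Δ * h + Y * D := by rw [hhD]; ring
    rw [e1, ← hhD]
    calc (Δ * h + Y * D) / c ≤ S := hlow
      _ ≤ _ := hup
      _ ≤ CF * (1 * L + h + D * Real.log (D + 2) + 2 * Real.sqrt (D * (h + D) * L)) :=
          mul_le_mul_of_nonneg_left (by linarith) hCF.le
      _ ≤ 2 * CF * (1 * L + h + D * Real.log (D + 2) + Real.sqrt (D * (h + D) * L)) := by
          nlinarith [mul_nonneg hCF.le hstuff]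
      _ ≤ C * (1 * L + h + D * Real.log (D + 2) + Real.sqrt (D * (h + D) * L)) :=
          mul_le_mul_of_nonneg_right hC2 hT0
  have hlogb : 8 * C * c * Real.log (D + 2) ≤ Y :=
    (SatelliteRestartGlue.log_budget hC hc hΔbig hD0.le hDle).trans hY
  have hDδ : Δ * 1 ≤ 4 * C * c * D := by
    have : D ≤ 4 * C * c * D := le_mul_of_one_le_left hD0.le (by linarith)
    linarith
  have hconc := floor_arith C c Δ Y D hbar L 1 hC hc hΔ8 hY hlogb hD1 hhbar0 le_rfl hDδ hL1 hfloor
  rw [hL, div_le_div_iff₀ (by positivity) (by positivity)] at hconc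
  have hpos : 0 < Δ * (Δ * hbar + Y) * (C ^ 2 * c ^ 2) := by positivity
  nlinarith [hpos]

/-- **The height budget of the restarted orbit** (Step 6 of the stub): from
`h(𝔯) ≤ C_R (Δ h(𝔮') + Y)`, `h(𝔮') ≤ p (h̄ + 1)`, `h̄ = h/D ≤ Y Δ` (`h ≤ c₁ Y Δ²`, `D ≥ c₁Δ`)
one gets `h(𝔯) ≤ C_R (2p + 1) Y Δ² ≤ c₂ Y Δ²`. [folklore] -/
theorem height_budget {CR p c₁ c₂ Δ Y D h hq hr : ℝ} (hCR : 0 ≤ CR) (hp : 0 ≤ p)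
    (hc₂ : CR * (2 * p + 1) ≤ c₂) (hΔ : 1 ≤ Δ) (hY : Δ ≤ Y) (hD : c₁ * Δ ≤ D) (hD0 : 0 < D)
    (hh : h ≤ c₁ * Y * Δ ^ 2) (hhq : hq ≤ p * (h / D + 1)) (hhr : hr ≤ CR * (Δ * hq + Y)) :
    hr ≤ c₂ * Y * Δ ^ 2 := by
  have hY0 : 0 ≤ Y := by linarith
  have hΔ0 : 0 ≤ Δ := by linarith
  have hYΔ : 1 ≤ Y * Δ := one_le_mul_of_one_le_of_one_le (hΔ.trans hY) hΔ
  -- `h / D ≤ Y Δ`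
  have h1 : h / D ≤ Y * Δ := by
    rw [div_le_iff₀ hD0]
    calc h ≤ c₁ * Y * Δ ^ 2 := hh
      _ = Y * Δ * (c₁ * Δ) := by ring
      _ ≤ Y * Δ * D := mul_le_mul_of_nonneg_left hD (by positivity)
  -- `Δ h(𝔮') ≤ 2 p Y Δ²`
  have h2 : Δ * hq ≤ 2 * p * Y * Δ ^ 2 := by
    have e1 : hq ≤ p * (Y * Δ + 1) := hhq.trans (mul_le_mul_of_nonneg_left (by linarith) hp)
    have e2 : Y * Δ + 1 ≤ 2 * (Y * Δ) := by linarith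
    have e3 : hq ≤ p * (2 * (Y * Δ)) := e1.trans (mul_le_mul_of_nonneg_left e2 hp)
    calc Δ * hq ≤ Δ * (p * (2 * (Y * Δ))) := mul_le_mul_of_nonneg_left e3 hΔ0
      _ = 2 * p * Y * Δ ^ 2 := by ring
  have h3 : Y ≤ Y * Δ ^ 2 := le_mul_of_one_le_right hY0 (one_le_pow₀ hΔ)
  calc hr ≤ CR * (Δ * hq + Y) := hhr
    _ ≤ CR * (2 * p * Y * Δ ^ 2 + Y * Δ ^ 2) := mul_le_mul_of_nonneg_left (add_le_add h2 h3) hCR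
    _ = CR * (2 * p + 1) * (Y * Δ ^ 2) := by ring
    _ ≤ c₂ * (Y * Δ ^ 2) := mul_le_mul_of_nonneg_right hc₂ (by positivity)
    _ = c₂ * Y * Δ ^ 2 := by ring

end PointDatumOfLineSatellite

/-- **Stub `pointDatum_of_lineSatellite3`** (crux `stmt-Schanuel-6117`, line
`orbit-interpolation-determinant`; the line-satellite branch of the bad cut of the `t = 3` transfer):
`OrbitFloor → SatelliteHeightLine → ContainerRestart →` for every `ω ∈ ℂ³` and `c₁ ≥ 1` there are
`λ ≥ 1` and `c ≥ c₁` such that, for `Y ≥ Δ ≥ c`, a long prime orbit `𝔭` (`⌊c₁Δ⌋ + 1 < deg 𝔭`, AP1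
bounds at constant `c₁` and scale `(Δ, λY)`) lying on a rational LINE `V(𝔮')` (`deg 𝔮' = 1`,
`𝔮' ∋ Q, P`, `(Q)` prime, `P ∉ (Q)`, `a + b ≤ 3Δ`) yields a `PointAPAbsAt 3`-datum at `(Δ, Y)`:
the smallness of the orbit forces `ω̄` within `e^{−L}` of the line (orbit floor, contrapositive),
the line is restarted (`ContainerRestart`) into a short orbit whose clause is automatic
(`rankOne_interpolation_of_ideg_le`), and `pointDatum_of_clause` extracts the point.
[cite: NesterenkoPhilippon2001, Ch. 3 Prop. 4.11 (pp. 40–41), Cor. 4.10; Ch. 4 §4 p. 61] -/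
theorem pointDatum_of_lineSatellite3 : OrbitFloor → SatelliteHeightLine → ContainerRestart → ∀ (ω : Fin 3 → ℂ) (c₁ : ℝ), 1 ≤ c₁ → ∃ lam : ℝ, 1 ≤ lam ∧ ∃ c : ℝ, c₁ ≤ c ∧ ∀ Δ Y : ℝ, c ≤ Δ → Δ ≤ Y → ∀ (Q : Rx 3) (a : ℕ) (P : Rx 3) (b : ℕ) (𝔮' 𝔭 : Ideal (Rx 3)), Q ≠ 0 → Q.IsHomogeneous a → P.IsHomogeneous b → 1 ≤ a → 1 ≤ b → (a : ℝ) + b ≤ 3 * Δ → (Ideal.span {Q}).IsPrime → P ∉ Ideal.span {Q} → 𝔮'.IsPrime → 𝔮'.IsHomogeneous (homogeneousSubmodule (Fin (3 + 1)) ℚ) → IsUnmixedOfRank 𝔮' 2 → Q ∈ 𝔮' → P ∈ 𝔮' → ideg 𝔮' 2 = 1 → 𝔭.IsPrime → 𝔭.IsHomogeneous (homogeneousSubmodule (Fin (3 + 1)) ℚ) → IsUnmixedOfRank 𝔭 1 → 𝔮' ≤ 𝔭 → ⌊c₁ * Δ⌋₊ + 1 < ideg 𝔭 1 → (ideg 𝔭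 1 : ℝ) ≤ (c₁ * Δ) ^ 3 → iheight 𝔭 1 ≤ c₁ * (lam * Y) * Δ ^ 2 → iabs 𝔭 1 (Fin.cons 1 ω) ≤ Real.exp (-((Δ * iheight 𝔭 1 + lam * Y * ideg 𝔭 1) / c₁)) → ∃ (K : Type) (_ : Field K) (_ : NumberField K) (β : Fin 3 → K) (σ : K →+* ℂ), (Module.finrank ℚ K : ℝ) ≤ (c * Δ) ^ 3 ∧ Height.logHeight (Fin.cons (1 : K) β : Fin (3 + 1) → K) ≤ c * Y * Δ ^ 2 ∧ ‖(fun j => σ (β j)) - ω‖ ≤ Real.exp (-((Δ * Height.logHeight (Fin.cons (1 : K) β : Fin (3 + 1) → K) + Y * Module.finrank ℚ K) / c)) := by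
  intro hF hH hR ω c₁ hc₁
  classical
  obtain ⟨C_F, hC_F, hFt⟩ := hF ω
  obtain ⟨C_H, _hC_H, hHt⟩ := hH
  obtain ⟨C_R, hC_R, hRt⟩ := hR ω
  -- the constants: `C₂ = 2 max(C_F, 1)` (floor), `p = max(C_H, 1)` (line height), and the
  -- certification constant `c₂` (a plain sum dominating every threshold below)
  obtain ⟨C₂, hC₂def⟩ : ∃ C₂ : ℝ, C₂ = 2 * max C_F 1 := ⟨_, rfl⟩
  obtain ⟨p, hpdef⟩ : ∃ p : ℝ, p = max C_H 1 := ⟨_, rfl⟩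
  have hC₂1 : 1 ≤ C₂ := by rw [hC₂def]; linarith [le_max_right C_F 1]
  have hCFC₂ : 2 * C_F ≤ C₂ := by rw [hC₂def]; linarith [le_max_left C_F 1]
  have hC₂0 : 0 ≤ C₂ := by linarith
  have hp1 : 1 ≤ p := by rw [hpdef]; exact le_max_right _ _
  have hp0 : 0 ≤ p := by linarith
  have hCHp : C_H ≤ p := by rw [hpdef]; exact le_max_left _ _
  have hC_R0 : 0 ≤ C_R := by linarith
  have hc₁0 : 0 ≤ c₁ := by linarith
  obtain ⟨c₂, hc₂def⟩ : ∃ c₂ : ℝ, c₂ = c₁ + 16 * C_R * (32 * C₂ ^ 2) * c₁ ^ 2 * (p + 1) * 1 +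
      C_R * (2 * p + 1) + 9 + 3136 * C₂ ^ 2 * c₁ ^ 3 + 8 * C₂ * c₁ := ⟨_, rfl⟩
  have t1 : 0 ≤ 16 * C_R * (32 * C₂ ^ 2) * c₁ ^ 2 * (p + 1) * 1 := by positivity
  have t2 : 0 ≤ C_R * (2 * p + 1) := by positivity
  have t3 : 0 ≤ 3136 * C₂ ^ 2 * c₁ ^ 3 := by positivity
  have t4 : 0 ≤ 8 * C₂ * c₁ := by positivity
  have hc₁c₂ : c₁ ≤ c₂ := by rw [hc₂def]; linarith
  have h16c₂ : 16 * C_R * (32 * C₂ ^ 2) * c₁ ^ 2 * (p + 1) * 1 ≤ c₂ := by rw [hc₂def]; linarith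
  have hCR2p : C_R * (2 * p + 1) ≤ c₂ := by rw [hc₂def]; linarith
  have h9c₂ : 9 ≤ c₂ := by rw [hc₂def]; linarith
  have h3136 : 3136 * C₂ ^ 2 * c₁ ^ 3 ≤ c₂ := by rw [hc₂def]; linarith
  have h8c₂ : 8 * C₂ * c₁ ≤ c₂ := by rw [hc₂def]; linarith
  have hCRc₂ : C_R ≤ c₂ :=
    (le_mul_of_one_le_right hC_R0 (by linarith : (1 : ℝ) ≤ 2 * p + 1)).trans hCR2p
  have hc₂1 : 1 ≤ c₂ := hc₁.trans hc₁c₂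
  have h32 : (1 : ℝ) ≤ 32 * C₂ ^ 2 :=
    one_le_mul_of_one_le_of_one_le (by norm_num) (one_le_pow₀ hC₂1)
  -- the landed per-scale transfer at the certification constant `c₂`
  obtain ⟨lam, hlam, c, hc, hT⟩ := pointDatum_of_clause 3 (by norm_num) stub_zeroDimDictionary
    (stub_sharpClosestPoint stub_orbitClusterBound stub_zeroDimDictionary) ω c₂ hc₂1
  refine ⟨lam, hlam, c, hc₁c₂.trans hc, ?_⟩
  intro Δ Y hΔ hY Q a P b 𝔮' 𝔭 hQ0 hQa hPb ha hb hab hQprime hPQ h𝔮' h𝔮'hom h𝔮'unm hQ𝔮' hP𝔮'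
    hdeg1 h𝔭 h𝔭hom h𝔭unm hle hDlong hdeg hht habs
  -- scalars
  have hc₂Δ : c₂ ≤ Δ := hc.trans hΔ
  have hΔ1 : 1 ≤ Δ := hc₂1.trans hc₂Δ
  have hΔ0 : 0 < Δ := by linarith
  have hY0 : 0 < Y := by linarith
  have hY' : Δ ≤ lam * Y := hY.trans (le_mul_of_one_le_left hY0.le hlam)
  have h8Δ : 8 * C₂ * c₁ ≤ Δ := h8c₂.trans hc₂Δ
  have h3136Δ : 3136 * C₂ ^ 2 * c₁ ^ 3 ≤ Δ := h3136.trans hc₂Δ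
  have h4c₂ : (4 : ℝ) ≤ c₂ := by linarith
  -- the orbit is long: `D > c₁ Δ ≥ Δ ≥ 9`, `D ≥ 2`
  have hDgt : c₁ * Δ < (ideg 𝔭 1 : ℝ) := by
    have h1 : c₁ * Δ < (⌊c₁ * Δ⌋₊ : ℝ) + 1 := Nat.lt_floor_add_one _
    have h2 : (⌊c₁ * Δ⌋₊ : ℝ) + 1 < (ideg 𝔭 1 : ℝ) := by exact_mod_cast hDlong
    linarith
  have hDΔ : Δ ≤ (ideg 𝔭 1 : ℝ) := by
    have : Δ ≤ c₁ * Δ := le_mul_of_one_le_left hΔ0.le hc₁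
    linarith
  have hD9 : (9 : ℝ) ≤ ideg 𝔭 1 := by linarith
  have hD0 : (0 : ℝ) < ideg 𝔭 1 := by linarith
  have h2D : 2 ≤ ideg 𝔭 1 := by omega
  have hh0 : 0 ≤ iheight 𝔭 1 := height_nonneg _
  have hhbar0 : 0 ≤ iheight 𝔭 1 / (ideg 𝔭 1 : ℝ) := div_nonneg hh0 hD0.le
  have hdeg1R : (ideg 𝔮' 2 : ℝ) = 1 := by rw [hdeg1, Nat.cast_one]
  -- Step 1: the floor scale `L` and a zero of `𝔭` within `e^{-L}` of `ω̄` (contrapositive floor)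
  obtain ⟨L, hLdef⟩ : ∃ L : ℝ,
      L = Δ * (Δ * (iheight 𝔭 1 / (ideg 𝔭 1 : ℝ)) + lam * Y) / (32 * C₂ ^ 2 * c₁ ^ 2) := ⟨_, rfl⟩
  have hL1 : 1 ≤ L := by
    rw [hLdef]; exact PointDatumOfLineSatellite.one_le_L hC₂1 hc₁ h8Δ hY' hhbar0
  have hnear : ∃ β ∈ projZeros 𝔭, projDist (Fin.cons 1 ω) β < Real.exp (-L) := by
    by_contra hfar
    push Not at hfar
    have hpos : 0 < iabs 𝔭 1 (Fin.cons 1 ω) :=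
      iabs_pos_of_far 𝔭 ω h𝔭 h𝔭hom h𝔭unm fun β hβ => (Real.exp_pos _).trans_le (hfar β hβ)
    have hlow : (Δ * iheight 𝔭 1 + lam * Y * ideg 𝔭 1) / c₁ ≤
        Real.log (1 / iabs 𝔭 1 (Fin.cons 1 ω)) := by
      rw [one_div, Real.log_inv]
      exact le_neg.mpr ((Real.log_le_iff_le_exp hpos).mpr habs)
    have hup := hFt 𝔭 𝔮' L h𝔭 h𝔭hom h𝔭unm h𝔮' h𝔮'hom h𝔮'unm hle hL1 hfar
    rw [hdeg1R] at hup
    exact PointDatumOfLineSatellite.floor_contra hC_F hCFC₂ hC₂1 hc₁ h8Δ h3136Δ hY' hDΔ hD9 hdeg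
      hh0 hLdef hlow hup
  -- Step 2: `ρ(ω̄, V(𝔮')) < e^{-L}` (a zero of `𝔭 ⊇ 𝔮'` is a zero of `𝔮'`)
  obtain ⟨β, hβ, hβlt⟩ := hnear
  have hβ' : β ∈ projZeros 𝔮' := ⟨hβ.1, fun f hf => hβ.2 f (hle hf)⟩
  have hρlt : rho (Fin.cons 1 ω) 𝔮' < Real.exp (-L) := (rho_le_projDist _ hβ').trans_lt hβlt
  -- Step 3: the restart threshold of the line is below `L`
  have hhq : iheight 𝔮' 2 ≤ p * (iheight 𝔭 1 / (ideg 𝔭 1 : ℝ) + 1) :=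
    (hHt 𝔭 𝔮' h𝔭 h𝔭hom h𝔭unm h𝔮' h𝔮'hom h𝔮'unm hdeg1 hle h2D).trans
      (mul_le_mul_of_nonneg_right hCHp (SatelliteRestartGlue.hbar_add_one_nonneg 𝔭))
  have hthr : C_R * (Δ / c₂ + 1) * (Δ * iheight 𝔮' 2 + lam * Y * 1) ≤ L :=
    restart_threshold_arith C_R (32 * C₂ ^ 2) c₁ c₂ Δ (lam * Y) (iheight 𝔭 1 / (ideg 𝔭 1 : ℝ))
      (iheight 𝔮' 2) 1 p L hC_R h32 hc₁ hp1 le_rfl h16c₂ hc₂Δ hY' hhbar0 hhq (le_of_eq hLdef.symm)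
  -- Step 4: restart the line at constant `c₂` and scale `(Δ, λY)`
  obtain ⟨𝔯, h𝔯, h𝔯hom, h𝔯unm, -, hdeg𝔯, hht𝔯, habs𝔯⟩ := hRt Q P a b 𝔮' hQ0 hQa hPb ha hb hQprime
    hPQ h𝔮' h𝔮'hom h𝔮'unm hQ𝔮' hP𝔮' c₂ Δ (lam * Y) hCRc₂ hc₂Δ hY' hab
    (by rw [hdeg1R]; exact hρlt.le.trans (Real.exp_le_exp.mpr (neg_le_neg hthr)))
  rw [hdeg1R, mul_one] at hdeg𝔯 hht𝔯
  -- Step 5: the clause is automatic for the short orbit `𝔯` (`deg 𝔯 ≤ 4Δ ≤ ⌊c₂Δ⌋ + 1`)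
  have hdeg𝔯c : (ideg 𝔯 1 : ℝ) ≤ c₂ * Δ := hdeg𝔯.trans (mul_le_mul_of_nonneg_right h4c₂ hΔ0.le)
  have hclause := rankOne_interpolation_of_ideg_le 3 𝔯 ⌊c₂ * Δ⌋₊ h𝔯 h𝔯hom h𝔯unm
    (by have := Nat.le_floor hdeg𝔯c; omega)
  -- Step 6: the per-scale transfer
  have hdeg𝔯3 : (ideg 𝔯 1 : ℝ) ≤ (c₂ * Δ) ^ 3 :=
    hdeg𝔯c.trans (le_self_pow₀ (one_le_mul_of_one_le_of_one_le hc₂1 hΔ1) three_ne_zero)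
  have hht𝔯' : iheight 𝔯 1 ≤ c₂ * (lam * Y) * Δ ^ 2 :=
    PointDatumOfLineSatellite.height_budget hC_R0 hp0 hCR2p hΔ1 hY' hDgt.le hD0 hht hhq hht𝔯
  exact hT Δ Y hΔ hY 𝔯 h𝔯 h𝔯hom h𝔯unm hdeg𝔯3 hht𝔯' habs𝔯 hclause

end Summit.Schanuel.Schanuel.Cruxes.ApproximationProperty.OrbitInterpolationDeterminant

end
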